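import Mathlib
import Summits.Ventures.PercRepro2.Defs
import Summits.Ventures.PercRepro2.Harris
import Summits.Ventures.PercRepro2.Graph
import Summits.Ventures.PercRepro2.Events
import Summits.Ventures.PercRepro2.BHKEvents
import Summits.Ventures.PercRepro2.PsiPinInduction
import Summits.Ventures.PercRepro2.PsiUniSure
import Summits.Ventures.PercRepro2.PsiUniExplored
import Summits.Ventures.PercRepro2.PsiTEdge
import Summits.Ventures.PercRepro2.R21PinInduction

import Summits.Ventures.PercRepro2.R21OEdgeSGraph
/-!
# The edge to `s` of the `o`-exploration satisfies (UNI-R_o) (PercRepro2, p2)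

Part of the one-edge hypothesis of the frame `r21_slack_nonneg_of_uni_o`: for an unpinned edge
`f = {x, s}` with `x` in the explored `o`-component, `2·min(R⁰, R¹) ≤ T_f` — in fact `R¹ = 0` (with
`f` open, `o ∈ C_s` surely) and `T_f ≥ R⁰`.  Opening `f` merges the cluster of `o` into the cluster
of `s`: on configurations respecting the pins, `s ↔ v` in the open world iff `s ↔ v` or `o ↔ v` in
the closed world (`conn_update_true_iff_or`, the one-edge connectivity lemma), so the nine open-world
masses are closed-world masses of the pair `(C_s, C_o)`.  With `N = {o ∉ C_s}`, `Y_∅ = {y ∉ C_s ∪ C_o}`,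
`Y_o = {y ∈ C_o}`, `U_o = {u ∈ C_o}`, `U_s = {u ∈ C_s}` one finds (P2-G19-YCLUSTER.md §3d)

  `T_f − R⁰ = P(N)·P(N,Y_∅,U_o) + P(N,Y_∅)·P(N,U_o) + [P(N,Y_o)·P(N,U_s) − P(N)·P(N,Y_o,U_s)]`

and the bracket is the cross-cluster inequality `bhk_cross_cluster` for the roots `(o, s)` with the
avoid event `N`.  This is the analogue of the degenerate cases `psi_bern_t_of_mark_*` of the
`t`-edge (P2-G18-BERN.md §7c) for the `o`-exploration of (R2-1).
-/

namespace Summit.Ventures.PercRepro2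


section OEdgeProb

variable {V : Type*} {E : Type*} [Fintype E] [DecidableEq E] [Fintype V] [DecidableEq V]
  {R : Type*} [CommRing R] [LinearOrder R] [IsStrictOrderedRing R]

omit [Fintype V] [DecidableEq V] [IsStrictOrderedRing R] in
/-- The nine masses of the open world `p[f↦1]` for `f = {x, s}`, `x` in the explored `o`-component,
as closed-world masses of `(C_s, C_o)`: `o ∈ C_s` is sure, `u ∈ C_s` becomes `u ∈ C_s ∪ C_o`,
`s ↮ y` becomes `y ∉ C_s ∪ C_o`, and `{y ↔ o, s ↮ y}` becomes impossible. -/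
lemma sEdge_transfer (p : E → R) (ends : E → Sym2 V) (s y o u x : V) (f : E)
    (hf : ends f = s(x, s)) (hx : Conn ends (fun e => decide (p e = 1)) o x) (hpf : p f ≠ 1) :
    prob (Function.update p f 1) (connEvent ends s u ∩ clusterInEvent ends s {W : Set V | o ∈ W} ∩ (connEvent ends s y)ᶜ) =
        prob (Function.update p f 0) ((connEvent ends s u ∪ connEvent ends o u) ∩ ((connEvent ends s y)ᶜ ∩ (connEvent ends o y)ᶜ)) ∧
      prob (Function.update p f 1) (connEvent ends s u ∩ connEvent ends y o ∩ (connEvent ends s y)ᶜ) = 0 ∧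
      prob (Function.update p f 1) (connEvent ends s y)ᶜ =
        prob (Function.update p f 0) ((connEvent ends s y)ᶜ ∩ (connEvent ends o y)ᶜ) ∧
      prob (Function.update p f 1) (connEvent ends s u ∩ clusterInEvent ends s {W : Set V | o ∈ W}) =
        prob (Function.update p f 0) (connEvent ends s u ∪ connEvent ends o u) ∧
      prob (Function.update p f 1) (connEvent ends s u ∩ (connEvent ends s y)ᶜ) =
        prob (Function.update p f 0) ((connEvent ends s u ∪ connEvent ends o u) ∩ ((connEvent ends s y)ᶜ ∩ (connEvent ends o y)ᶜ)) ∧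
      prob (Function.update p f 1) (clusterInEvent ends s {W : Set V | o ∈ W}) = 1 ∧
      prob (Function.update p f 1) (clusterInEvent ends s {W : Set V | o ∈ W} ∩ (connEvent ends s y)ᶜ) =
        prob (Function.update p f 0) ((connEvent ends s y)ᶜ ∩ (connEvent ends o y)ᶜ) ∧
      prob (Function.update p f 1) (connEvent ends s u) =
        prob (Function.update p f 0) (connEvent ends s u ∪ connEvent ends o u) ∧
      prob (Function.update p f 1) (connEvent ends y o ∩ (connEvent ends s y)ᶜ) = 0 := by
  have key : ∀ (A A' : Set (Config E)),
      (∀ ω : Config E, (∀ e, e ≠ f → p e = 1 → ω e = true) →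
        (Function.update ω f true ∈ A ↔ Function.update ω f false ∈ A')) →
      prob (Function.update p f 1) A = prob (Function.update p f 0) A' :=
    fun A A' h => prob_update_one_eq_prob_update_zero_of_respects p f fun ω _ h1 => h ω h1
  have hsv : ∀ (ω : Config E), (∀ e, e ≠ f → p e = 1 → ω e = true) → ∀ v,
      Conn ends (Function.update ω f true) s v ↔
        Conn ends (Function.update ω f false) s v ∨ Conn ends (Function.update ω f false) o v :=
    fun ω h1 v => conn_update_true_s_iff_or_o hf hx hpf h1 v
  have hyo : ∀ (ω : Config E), (∀ e, e ≠ f → p e = 1 → ω e = true) →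
      (Conn ends (Function.update ω f true) y o ↔
        Conn ends (Function.update ω f false) y o ∨ Conn ends (Function.update ω f false) y s) :=
    fun ω h1 => conn_update_true_y_o_iff hf hx hpf h1
  have h0 : prob (Function.update p f 0) (∅ : Set (Config E)) = 0 := prob_empty _
  have huniv : prob (Function.update p f 0) (Set.univ : Set (Config E)) = 1 := prob_univ _
  refine ⟨?_, ?_, ?_, ?_, ?_, ?_, ?_, ?_, ?_⟩
  · refine key _ _ fun ω h1 => ?_
    simp only [Set.mem_inter_iff, mem_connEvent, mem_clusterInEvent, Set.mem_setOf_eq, mem_cluster,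
      Set.mem_compl_iff, Set.mem_union, hsv ω h1, conn_refl, or_true, and_true, not_or]
  · refine (key _ ∅ fun ω h1 => ?_).trans h0
    simp only [Set.mem_inter_iff, mem_connEvent, Set.mem_compl_iff, Set.mem_empty_iff_false,
      iff_false, hsv ω h1, hyo ω h1, not_or]
    rintro ⟨⟨_, hyo' | hys⟩, hsy, hoy⟩
    · exact hoy (conn_symm hyo')
    · exact hsy (conn_symm hys)
  · refine key _ _ fun ω h1 => ?_
    simp only [Set.mem_inter_iff, mem_connEvent, Set.mem_compl_iff, hsv ω h1, not_or]
  · refine key _ _ fun ω h1 => ?_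
    simp only [Set.mem_inter_iff, mem_connEvent, mem_clusterInEvent, Set.mem_setOf_eq, mem_cluster,
      Set.mem_union, hsv ω h1, conn_refl, or_true, and_true]
  · refine key _ _ fun ω h1 => ?_
    simp only [Set.mem_inter_iff, mem_connEvent, Set.mem_compl_iff, Set.mem_union, hsv ω h1, not_or]
  · refine (key _ Set.univ fun ω h1 => ?_).trans huniv
    simp only [mem_clusterInEvent, Set.mem_setOf_eq, mem_cluster, hsv ω h1, conn_refl, or_true,
      Set.mem_univ]
  · refine key _ _ fun ω h1 => ?_
    simp only [Set.mem_inter_iff, mem_connEvent, mem_clusterInEvent, Set.mem_setOf_eq, mem_cluster,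
      Set.mem_compl_iff, hsv ω h1, conn_refl, or_true, true_and, not_or]
  · refine key _ _ fun ω h1 => ?_
    simp only [mem_connEvent, Set.mem_union, hsv ω h1]
  · refine (key _ ∅ fun ω h1 => ?_).trans h0
    simp only [Set.mem_inter_iff, mem_connEvent, Set.mem_compl_iff, Set.mem_empty_iff_false,
      iff_false, hsv ω h1, hyo ω h1, not_or]
    rintro ⟨hyo' | hys, hsy, hoy⟩
    · exact hoy (conn_symm hyo')
    · exact hsy (conn_symm hys)

omit [Fintype V] [DecidableEq V] [LinearOrder R] [IsStrictOrderedRing R] in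
/-- The closed-world masses of (R2-1) and the three open-world masses, decomposed over
`N = {o ∉ C_s}` into the seven `N`-masses `m₁ … m₇` and the three `Nᶜ`-masses `c₁ c₂ c₃`:
`m₁ = P(N,Y_∅,U_o)`, `m₂ = P(N,Y_∅)`, `m₃ = P(N,U_o)`, `m₄ = P(N,Y_o,U_s)`, `m₅ = P(N,Y_o)`,
`m₆ = P(N,U_s)`, `m₇ = P(N,Y_∅,U_s)`, `c₁ = P(Nᶜ,𝟙,a)`, `c₂ = P(Nᶜ,𝟙)`, `c₃ = P(Nᶜ,a)`. -/
lemma sEdge_masses (q : E → R) (ends : E → Sym2 V) (s y o u : V) :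
    prob q (connEvent ends s u ∩ clusterInEvent ends s {W : Set V | o ∈ W} ∩ (connEvent ends s y)ᶜ) =
        prob q (connEvent ends o s ∩ (connEvent ends s y)ᶜ ∩ connEvent ends s u) ∧
      prob q (connEvent ends s u ∩ connEvent ends y o ∩ (connEvent ends s y)ᶜ) =
        prob q ((connEvent ends o s)ᶜ ∩ connEvent ends o y ∩ connEvent ends s u) ∧
      prob q (connEvent ends s y)ᶜ =
        prob q ((connEvent ends o s)ᶜ ∩ ((connEvent ends s y)ᶜ ∩ (connEvent ends o y)ᶜ)) +
          prob q ((connEvent ends o s)ᶜ ∩ connEvent ends o y) +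
          prob q (connEvent ends o s ∩ (connEvent ends s y)ᶜ) ∧
      prob q (connEvent ends s u ∩ clusterInEvent ends s {W : Set V | o ∈ W}) =
        prob q (connEvent ends o s ∩ connEvent ends s u) ∧
      prob q (connEvent ends s u ∩ (connEvent ends s y)ᶜ) =
        prob q ((connEvent ends o s)ᶜ ∩ ((connEvent ends s y)ᶜ ∩ (connEvent ends o y)ᶜ) ∩ connEvent ends s u) +
          prob q ((connEvent ends o s)ᶜ ∩ connEvent ends o y ∩ connEvent ends s u) +
          prob q (connEvent ends o s ∩ (connEvent ends s y)ᶜ ∩ connEvent ends s u) ∧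
      prob q (clusterInEvent ends s {W : Set V | o ∈ W}) = 1 - prob q (connEvent ends o s)ᶜ ∧
      prob q (clusterInEvent ends s {W : Set V | o ∈ W} ∩ (connEvent ends s y)ᶜ) =
        prob q (connEvent ends o s ∩ (connEvent ends s y)ᶜ) ∧
      prob q (connEvent ends s u) =
        prob q ((connEvent ends o s)ᶜ ∩ connEvent ends s u) + prob q (connEvent ends o s ∩ connEvent ends s u) ∧
      prob q (connEvent ends y o ∩ (connEvent ends s y)ᶜ) =
        prob q ((connEvent ends o s)ᶜ ∩ connEvent ends o y) ∧
      prob q ((connEvent ends s u ∪ connEvent ends o u) ∩ ((connEvent ends s y)ᶜ ∩ (connEvent ends o y)ᶜ)) =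
        prob q ((connEvent ends o s)ᶜ ∩ ((connEvent ends s y)ᶜ ∩ (connEvent ends o y)ᶜ) ∩ connEvent ends s u) +
          prob q ((connEvent ends o s)ᶜ ∩ ((connEvent ends s y)ᶜ ∩ (connEvent ends o y)ᶜ) ∩ connEvent ends o u) +
          prob q (connEvent ends o s ∩ (connEvent ends s y)ᶜ ∩ connEvent ends s u) ∧
      prob q (connEvent ends s u ∪ connEvent ends o u) =
        prob q ((connEvent ends o s)ᶜ ∩ connEvent ends s u) + prob q ((connEvent ends o s)ᶜ ∩ connEvent ends o u) +
          prob q (connEvent ends o s ∩ connEvent ends s u) ∧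
      prob q ((connEvent ends s y)ᶜ ∩ (connEvent ends o y)ᶜ) =
        prob q ((connEvent ends o s)ᶜ ∩ ((connEvent ends s y)ᶜ ∩ (connEvent ends o y)ᶜ)) +
          prob q (connEvent ends o s ∩ (connEvent ends s y)ᶜ) := by
  classical
  -- abbreviations
  set N : Set (Config E) := (connEvent ends o s)ᶜ with hN
  have hNc : Nᶜ = connEvent ends o s := by simp [hN]
  have hh : clusterInEvent ends s {W : Set V | o ∈ W} = connEvent ends o s := by
    rw [clusterInEvent_mem_eq_connEvent_ycl, connEvent_comm]
  -- the generic split of a mass over `N`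
  have split : ∀ X : Set (Config E), prob q X = prob q (X ∩ N) + prob q (X ∩ Nᶜ) :=
    fun X => (prob_inter_add_prob_inter_compl q X N).symm
  -- membership facts
  have mN : ∀ ω : Config E, ω ∈ N ↔ ¬ Conn ends ω o s := fun ω => Iff.rfl
  have mNc : ∀ ω : Config E, ω ∈ Nᶜ ↔ Conn ends ω o s := fun ω => by simp [hN]
  refine ⟨?_, ?_, ?_, ?_, ?_, ?_, ?_, ?_, ?_, ?_, ?_, ?_⟩
  · -- A₁
    rw [hh]; congr 1; ext ω
    simp only [Set.mem_inter_iff, mem_connEvent, Set.mem_compl_iff]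
    constructor
    · rintro ⟨⟨ha, hos⟩, hq⟩; exact ⟨⟨hos, hq⟩, ha⟩
    · rintro ⟨⟨hos, hq⟩, ha⟩; exact ⟨⟨ha, hos⟩, hq⟩
  · -- A₂ = m₄
    congr 1; ext ω
    simp only [Set.mem_inter_iff, mem_connEvent, Set.mem_compl_iff]
    constructor
    · rintro ⟨⟨ha, hyo⟩, hsy⟩
      exact ⟨⟨fun hos => hsy (conn_trans (conn_symm hos) (conn_symm hyo)), conn_symm hyo⟩, ha⟩
    · rintro ⟨⟨hos, hoy⟩, ha⟩
      exact ⟨⟨ha, conn_symm hoy⟩, fun hsy => hos (conn_symm (conn_trans hsy (conn_symm hoy)))⟩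
  · -- A₃ = m₂ + m₅ + c₂
    rw [split (connEvent ends s y)ᶜ,
      ← prob_inter_add_prob_inter_compl q ((connEvent ends s y)ᶜ ∩ N) (connEvent ends o y)]
    have e1 : (connEvent ends s y)ᶜ ∩ N ∩ connEvent ends o y = N ∩ connEvent ends o y := by
      ext ω
      simp only [Set.mem_inter_iff, Set.mem_compl_iff, mem_connEvent, hN]
      constructor
      · rintro ⟨⟨_, hos⟩, hoy⟩; exact ⟨hos, hoy⟩
      · rintro ⟨hos, hoy⟩; exact ⟨⟨fun hsy => hos (conn_symm (conn_trans hsy (conn_symm hoy))), hos⟩, hoy⟩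
    have e2 : (connEvent ends s y)ᶜ ∩ N ∩ (connEvent ends o y)ᶜ =
        N ∩ ((connEvent ends s y)ᶜ ∩ (connEvent ends o y)ᶜ) := by
      ext ω; simp only [Set.mem_inter_iff]; tauto
    have e3 : (connEvent ends s y)ᶜ ∩ Nᶜ = connEvent ends o s ∩ (connEvent ends s y)ᶜ := by
      rw [hNc, Set.inter_comm]
    rw [e1, e2, e3]; ring
  · -- A₄ = c₃
    rw [hh, Set.inter_comm]
  · -- A₅ = m₇ + m₄ + c₁
    rw [split (connEvent ends s u ∩ (connEvent ends s y)ᶜ),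
      ← prob_inter_add_prob_inter_compl q (connEvent ends s u ∩ (connEvent ends s y)ᶜ ∩ N)
        (connEvent ends o y)]
    have e1 : connEvent ends s u ∩ (connEvent ends s y)ᶜ ∩ N ∩ connEvent ends o y =
        N ∩ connEvent ends o y ∩ connEvent ends s u := by
      ext ω
      simp only [Set.mem_inter_iff, Set.mem_compl_iff, mem_connEvent, hN]
      constructor
      · rintro ⟨⟨⟨ha, _⟩, hos⟩, hoy⟩; exact ⟨⟨hos, hoy⟩, ha⟩
      · rintro ⟨⟨hos, hoy⟩, ha⟩
        exact ⟨⟨⟨ha, fun hsy => hos (conn_symm (conn_trans hsy (conn_symm hoy)))⟩, hos⟩, hoy⟩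
    have e2 : connEvent ends s u ∩ (connEvent ends s y)ᶜ ∩ N ∩ (connEvent ends o y)ᶜ =
        N ∩ ((connEvent ends s y)ᶜ ∩ (connEvent ends o y)ᶜ) ∩ connEvent ends s u := by
      ext ω; simp only [Set.mem_inter_iff]; tauto
    have e3 : connEvent ends s u ∩ (connEvent ends s y)ᶜ ∩ Nᶜ =
        connEvent ends o s ∩ (connEvent ends s y)ᶜ ∩ connEvent ends s u := by
      rw [hNc]; ext ω; simp only [Set.mem_inter_iff]; tauto
    rw [e1, e2, e3]; ring
  · -- A₆ = 1 − n
    rw [hh]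
    have := prob_compl q (connEvent ends o s)
    rw [← hN] at this
    linear_combination this
  · -- A₇ = c₂
    rw [hh]
  · -- A₈ = m₆ + c₃
    rw [split (connEvent ends s u), hNc, Set.inter_comm (connEvent ends s u) N,
      Set.inter_comm (connEvent ends s u) (connEvent ends o s)]
  · -- A₉ = m₅
    congr 1; ext ω
    simp only [Set.mem_inter_iff, Set.mem_compl_iff, mem_connEvent, hN]
    constructor
    · rintro ⟨hyo, hsy⟩; exact ⟨fun hos => hsy (conn_trans (conn_symm hos) (conn_symm hyo)), conn_symm hyo⟩
    · rintro ⟨hos, hoy⟩; exact ⟨conn_symm hoy, fun hsy => hos (conn_symm (conn_trans hsy (conn_symm hoy)))⟩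
  · -- α = m₇ + m₁ + c₁
    rw [split ((connEvent ends s u ∪ connEvent ends o u) ∩ ((connEvent ends s y)ᶜ ∩ (connEvent ends o y)ᶜ))]
    have e1 : (connEvent ends s u ∪ connEvent ends o u) ∩ ((connEvent ends s y)ᶜ ∩ (connEvent ends o y)ᶜ) ∩ N =
        N ∩ ((connEvent ends s y)ᶜ ∩ (connEvent ends o y)ᶜ) ∩ connEvent ends s u ∪
          N ∩ ((connEvent ends s y)ᶜ ∩ (connEvent ends o y)ᶜ) ∩ connEvent ends o u := by
      ext ω; simp only [Set.mem_inter_iff, Set.mem_union]; tauto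
    have hd : Disjoint (N ∩ ((connEvent ends s y)ᶜ ∩ (connEvent ends o y)ᶜ) ∩ connEvent ends s u)
        (N ∩ ((connEvent ends s y)ᶜ ∩ (connEvent ends o y)ᶜ) ∩ connEvent ends o u) := by
      rw [Set.disjoint_left]
      rintro ω ⟨⟨hos, _⟩, hsu⟩ ⟨_, hou⟩
      exact hos (conn_trans hou (conn_symm hsu))
    have e2 : (connEvent ends s u ∪ connEvent ends o u) ∩ ((connEvent ends s y)ᶜ ∩ (connEvent ends o y)ᶜ) ∩ Nᶜ =
        connEvent ends o s ∩ (connEvent ends s y)ᶜ ∩ connEvent ends s u := by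
      rw [hNc]; ext ω
      simp only [Set.mem_inter_iff, Set.mem_union, Set.mem_compl_iff, mem_connEvent]
      constructor
      · rintro ⟨⟨hsu | hou, hsy, _⟩, hos⟩
        · exact ⟨⟨hos, hsy⟩, hsu⟩
        · exact ⟨⟨hos, hsy⟩, conn_trans (conn_symm hos) hou⟩
      · rintro ⟨⟨hos, hsy⟩, hsu⟩
        exact ⟨⟨Or.inl hsu, hsy, fun hoy => hsy (conn_trans (conn_symm hos) hoy)⟩, hos⟩
    rw [e1, prob_union_of_disjoint q hd, e2]
  · -- β = m₆ + m₃ + c₃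
    rw [split (connEvent ends s u ∪ connEvent ends o u)]
    have e1 : (connEvent ends s u ∪ connEvent ends o u) ∩ N =
        N ∩ connEvent ends s u ∪ N ∩ connEvent ends o u := by
      ext ω; simp only [Set.mem_inter_iff, Set.mem_union]; tauto
    have hd : Disjoint (N ∩ connEvent ends s u) (N ∩ connEvent ends o u) := by
      rw [Set.disjoint_left]
      rintro ω ⟨hos, hsu⟩ ⟨_, hou⟩
      exact hos (conn_trans hou (conn_symm hsu))
    have e2 : (connEvent ends s u ∪ connEvent ends o u) ∩ Nᶜ = connEvent ends o s ∩ connEvent ends s u := by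
      rw [hNc]; ext ω
      simp only [Set.mem_inter_iff, Set.mem_union, mem_connEvent]
      constructor
      · rintro ⟨hsu | hou, hos⟩
        · exact ⟨hos, hsu⟩
        · exact ⟨hos, conn_trans (conn_symm hos) hou⟩
      · rintro ⟨hos, hsu⟩; exact ⟨Or.inl hsu, hos⟩
    rw [e1, prob_union_of_disjoint q hd, e2]
  · -- γ = m₂ + c₂
    rw [split ((connEvent ends s y)ᶜ ∩ (connEvent ends o y)ᶜ), Set.inter_comm _ N]
    have e2 : (connEvent ends s y)ᶜ ∩ (connEvent ends o y)ᶜ ∩ Nᶜ =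
        connEvent ends o s ∩ (connEvent ends s y)ᶜ := by
      rw [hNc]; ext ω
      simp only [Set.mem_inter_iff, Set.mem_compl_iff, mem_connEvent]
      constructor
      · rintro ⟨⟨hsy, _⟩, hos⟩; exact ⟨hos, hsy⟩
      · rintro ⟨hos, hsy⟩; exact ⟨⟨hsy, fun hoy => hsy (conn_trans (conn_symm hos) hoy)⟩, hos⟩
    rw [e2]

omit [Fintype E] [DecidableEq E] [Fintype V] [DecidableEq V] [LinearOrder R] [IsStrictOrderedRing R] in
/-- `{W | v ∈ W}` is an up-set of vertex sets. -/
lemma isUpperSet_memFamily_ycl (v : V) : IsUpperSet {W : Set V | v ∈ W} := fun _ _ h hW => h hW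

/-- **The edge to `s` of the `o`-exploration satisfies (UNI-R_o).** For an unpinned edge `f = {x, s}`
with `x` in the explored `o`-component, `2·min(R(p[f↦0]), R(p[f↦1])) ≤ T_f(p)` — the hypothesis of the
frame `r21_slack_nonneg_of_uni_o` at this edge: `R(p[f↦1]) = 0` and
`T_f − R(p[f↦0]) = P(N)·P(N,Y_∅,U_o) + P(N,Y_∅)·P(N,U_o) + [P(N,Y_o)·P(N,U_s) − P(N)·P(N,Y_o,U_s)] ≥ 0`
by the cross-cluster inequality `bhk_cross_cluster` for the roots `(o, s)`. -/
theorem r21_uni_o_edge_s (p : E → R) (hp : IsProbVec p) (ends : E → Sym2 V) (s y o u x : V) (f : E)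
    (hf : ends f = s(x, s)) (hx : Conn ends (fun e => decide (p e = 1)) o x) (hpf : p f ≠ 1) :
    2 * min (prob (Function.update p f 0) (connEvent ends s u ∩ clusterInEvent ends s {W : Set V | o ∈ W} ∩ (connEvent ends s y)ᶜ) + prob (Function.update p f 0) (connEvent ends s u ∩ connEvent ends y o ∩ (connEvent ends s y)ᶜ) + prob (Function.update p f 0) ((connEvent ends s y)ᶜ) * prob (Function.update p f 0) (connEvent ends s u ∩ clusterInEvent ends s {W : Set V | o ∈ W}) - (prob (Function.update p f 0) (connEvent ends s u ∩ (connEvent ends s y)ᶜ) * prob (Function.update p f 0) (clusterInEvent ends s {W : Set V | o ∈ W}) + prob (Function.update p f 0) (clusterInEvent ends s {W : Set V | o ∈ W} ∩ (connEvent ends s y)ᶜ) * prob (Function.update p f 0) (connEvent ends s u) + prob (Function.update p f 0) (connEvent ends y o ∩ (connEvent ends s y)ᶜ) * prob (Function.update p f 0) (connEvent ends s u))) (prob (Function.update p f 1) (connEvent ends s u ∩ clusterInEvent ends s {W : Set V | o ∈ W} ∩ (connEvent ends s y)ᶜ) + prob (Function.update p f 1) (connEvent ends s u ∩ connEvent ends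 y o ∩ (connEvent ends s y)ᶜ) + prob (Function.update p f 1) ((connEvent ends s y)ᶜ) * prob (Function.update p f 1) (connEvent ends s u ∩ clusterInEvent ends s {W : Set V | o ∈ W}) - (prob (Function.update p f 1) (connEvent ends s u ∩ (connEvent ends s y)ᶜ) * prob (Function.update p f 1) (clusterInEvent ends s {W : Set V | o ∈ W}) + prob (Function.update p f 1) (clusterInEvent ends s {W : Set V | o ∈ W} ∩ (connEvent ends s y)ᶜ) * prob (Function.update p f 1) (connEvent ends s u) + prob (Function.update p f 1) (connEvent ends y o ∩ (connEvent ends s y)ᶜ) * prob (Function.update p f 1) (connEvent ends s u))) ≤ (prob (Function.update p f 0) (connEvent ends s u ∩ clusterInEvent ends s {W : Set V | o ∈ W} ∩ (connEvent ends s y)ᶜ) + prob (Function.update p f 1) (connEvent ends s u ∩ clusterInEvent ends s {W : Set V | o ∈ W} ∩ (connEvent ends s y)ᶜ) + prob (Function.update p f 0) (connEvent ends s u ∩ connEvent ends y o ∩ (connEvent ends s y)ᶜ) + prob (Function.update p f 1) (connEvent ends s u ∩ connEvent ends y o ∩ (connEvent ends s y)ᶜ) + prob (Function.update p f 0) ((connEvent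 ends s y)ᶜ) * prob (Function.update p f 1) (connEvent ends s u ∩ clusterInEvent ends s {W : Set V | o ∈ W}) + prob (Function.update p f 1) ((connEvent ends s y)ᶜ) * prob (Function.update p f 0) (connEvent ends s u ∩ clusterInEvent ends s {W : Set V | o ∈ W}) - (prob (Function.update p f 0) (connEvent ends s u ∩ (connEvent ends s y)ᶜ) * prob (Function.update p f 1) (clusterInEvent ends s {W : Set V | o ∈ W}) + prob (Function.update p f 1) (connEvent ends s u ∩ (connEvent ends s y)ᶜ) * prob (Function.update p f 0) (clusterInEvent ends s {W : Set V | o ∈ W}) + prob (Function.update p f 0) (clusterInEvent ends s {W : Set V | o ∈ W} ∩ (connEvent ends s y)ᶜ) * prob (Function.update p f 1) (connEvent ends s u) + prob (Function.update p f 1) (clusterInEvent ends s {W : Set V | o ∈ W} ∩ (connEvent ends s y)ᶜ) * prob (Function.update p f 0) (connEvent ends s u) + prob (Function.update p f 0) (connEvent ends y o ∩ (connEvent ends s y)ᶜ) * prob (Function.update p f 1) (connEvent ends s u) + prob (Function.update p f 1) (connEvent ends y o ∩ (connEvent ends s y)ᶜ) * prob (Function.update p f 0) (connEvent ends s u)))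 := by
  classical
  have hq : IsProbVec (Function.update p f 0) := hp.update f le_rfl zero_le_one
  obtain ⟨t1, t2, t3, t4, t5, t6, t7, t8, t9⟩ := sEdge_transfer p ends s y o u x f hf hx hpf
  obtain ⟨d1, d2, d3, d4, d5, d6, d7, d8, d9, da, db, dc⟩ :=
    sEdge_masses (Function.update p f 0) ends s y o u
  rw [t1, t2, t3, t4, t5, t6, t7, t8, t9, d1, d2, d3, d4, d5, d6, d7, d8, d9, da, db, dc]
  -- the cross-cluster inequality for the roots `(o, s)` with the avoid event `N = {o ∉ C_s}`
  have hbhk := bhk_cross_cluster (Function.update p f 0) hq ends o s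
    (isUpperSet_memFamily_ycl y) (isUpperSet_memFamily_ycl u)
  rw [clusterInEvent_mem_eq_connEvent_ycl, clusterInEvent_mem_eq_connEvent_ycl] at hbhk
  have e4 : connEvent ends o y ∩ connEvent ends s u ∩ (connEvent ends o s)ᶜ =
      (connEvent ends o s)ᶜ ∩ connEvent ends o y ∩ connEvent ends s u := by
    ext ω; simp only [Set.mem_inter_iff]; tauto
  have e5 : connEvent ends o y ∩ (connEvent ends o s)ᶜ = (connEvent ends o s)ᶜ ∩ connEvent ends o y :=
    Set.inter_comm _ _
  have e6 : connEvent ends s u ∩ (connEvent ends o s)ᶜ = (connEvent ends o s)ᶜ ∩ connEvent ends s u :=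
    Set.inter_comm _ _
  rw [e4, e5, e6] at hbhk
  have hn := prob_nonneg hq (connEvent ends o s)ᶜ
  have hm1 := prob_nonneg hq ((connEvent ends o s)ᶜ ∩ ((connEvent ends s y)ᶜ ∩ (connEvent ends o y)ᶜ) ∩ connEvent ends o u)
  have hm2 := prob_nonneg hq ((connEvent ends o s)ᶜ ∩ ((connEvent ends s y)ᶜ ∩ (connEvent ends o y)ᶜ))
  have hm3 := prob_nonneg hq ((connEvent ends o s)ᶜ ∩ connEvent ends o u)
  have hmin1 := min_le_left (prob (Function.update p f 0) (connEvent ends o s ∩ (connEvent ends s y)ᶜ ∩ connEvent ends s u) + prob (Function.update p f 0) ((connEvent ends o s)ᶜ ∩ connEvent ends o y ∩ connEvent ends s u) + (prob (Function.update p f 0) ((connEvent ends o s)ᶜ ∩ ((connEvent ends s y)ᶜ ∩ (connEvent ends o y)ᶜ)) + prob (Function.update p f 0) ((connEvent ends o s)ᶜ ∩ connEvent ends o y) + prob (Function.update p f 0) (connEvent ends o s ∩ (connEvent ends s y)ᶜ)) * prob (Function.update p f 0) (connEvent ends o s ∩ connEvent ends s u) - ((prob (Function.update p f 0) ((connEvent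 ends o s)ᶜ ∩ ((connEvent ends s y)ᶜ ∩ (connEvent ends o y)ᶜ) ∩ connEvent ends s u) + prob (Function.update p f 0) ((connEvent ends o s)ᶜ ∩ connEvent ends o y ∩ connEvent ends s u) + prob (Function.update p f 0) (connEvent ends o s ∩ (connEvent ends s y)ᶜ ∩ connEvent ends s u)) * (1 - prob (Function.update p f 0) (connEvent ends o s)ᶜ) + prob (Function.update p f 0) (connEvent ends o s ∩ (connEvent ends s y)ᶜ) * (prob (Function.update p f 0) ((connEvent ends o s)ᶜ ∩ connEvent ends s u) + prob (Function.update p f 0) (connEvent ends o s ∩ connEvent ends s u)) + prob (Function.update p f 0) ((connEvent ends o s)ᶜ ∩ connEvent ends o y) * (prob (Function.update p f 0) ((connEvent ends o s)ᶜ ∩ connEvent ends s u) + prob (Function.update p f 0) (connEvent ends o s ∩ connEvent ends s u)))) ((prob (Function.update p f 0) ((connEvent ends o s)ᶜ ∩ ((connEvent ends s y)ᶜ ∩ (connEvent ends o y)ᶜ) ∩ connEvent ends s u) + prob (Function.update p f 0) ((connEvent ends o s)ᶜ ∩ ((connEvent ends s y)ᶜ ∩ (connEvent ends o y)ᶜ)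 ∩ connEvent ends o u) + prob (Function.update p f 0) (connEvent ends o s ∩ (connEvent ends s y)ᶜ ∩ connEvent ends s u)) + 0 + (prob (Function.update p f 0) ((connEvent ends o s)ᶜ ∩ ((connEvent ends s y)ᶜ ∩ (connEvent ends o y)ᶜ)) + prob (Function.update p f 0) (connEvent ends o s ∩ (connEvent ends s y)ᶜ)) * (prob (Function.update p f 0) ((connEvent ends o s)ᶜ ∩ connEvent ends s u) + prob (Function.update p f 0) ((connEvent ends o s)ᶜ ∩ connEvent ends o u) + prob (Function.update p f 0) (connEvent ends o s ∩ connEvent ends s u)) - ((prob (Function.update p f 0) ((connEvent ends o s)ᶜ ∩ ((connEvent ends s y)ᶜ ∩ (connEvent ends o y)ᶜ) ∩ connEvent ends s u) + prob (Function.update p f 0) ((connEvent ends o s)ᶜ ∩ ((connEvent ends s y)ᶜ ∩ (connEvent ends o y)ᶜ) ∩ connEvent ends o u) + prob (Function.update p f 0) (connEvent ends o s ∩ (connEvent ends s y)ᶜ ∩ connEvent ends s u)) * 1 + (prob (Function.update p f 0) ((connEvent ends o s)ᶜ ∩ ((connEvent ends s y)ᶜ ∩ (connEvent ends o y)ᶜ))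 + prob (Function.update p f 0) (connEvent ends o s ∩ (connEvent ends s y)ᶜ)) * (prob (Function.update p f 0) ((connEvent ends o s)ᶜ ∩ connEvent ends s u) + prob (Function.update p f 0) ((connEvent ends o s)ᶜ ∩ connEvent ends o u) + prob (Function.update p f 0) (connEvent ends o s ∩ connEvent ends s u)) + 0 * (prob (Function.update p f 0) ((connEvent ends o s)ᶜ ∩ connEvent ends s u) + prob (Function.update p f 0) ((connEvent ends o s)ᶜ ∩ connEvent ends o u) + prob (Function.update p f 0) (connEvent ends o s ∩ connEvent ends s u))))
  have hmin2 := min_le_right (prob (Function.update p f 0) (connEvent ends o s ∩ (connEvent ends s y)ᶜ ∩ connEvent ends s u) + prob (Function.update p f 0) ((connEvent ends o s)ᶜ ∩ connEvent ends o y ∩ connEvent ends s u) + (prob (Function.update p f 0) ((connEvent ends o s)ᶜ ∩ ((connEvent ends s y)ᶜ ∩ (connEvent ends o y)ᶜ)) + prob (Function.update p f 0) ((connEvent ends o s)ᶜ ∩ connEvent ends o y) + prob (Function.update p f 0) (connEvent ends o s ∩ (connEvent ends s y)ᶜ)) * prob (Function.update p f 0) (connEvent ends o s ∩ connEvent ends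 s u) - ((prob (Function.update p f 0) ((connEvent ends o s)ᶜ ∩ ((connEvent ends s y)ᶜ ∩ (connEvent ends o y)ᶜ) ∩ connEvent ends s u) + prob (Function.update p f 0) ((connEvent ends o s)ᶜ ∩ connEvent ends o y ∩ connEvent ends s u) + prob (Function.update p f 0) (connEvent ends o s ∩ (connEvent ends s y)ᶜ ∩ connEvent ends s u)) * (1 - prob (Function.update p f 0) (connEvent ends o s)ᶜ) + prob (Function.update p f 0) (connEvent ends o s ∩ (connEvent ends s y)ᶜ) * (prob (Function.update p f 0) ((connEvent ends o s)ᶜ ∩ connEvent ends s u) + prob (Function.update p f 0) (connEvent ends o s ∩ connEvent ends s u)) + prob (Function.update p f 0) ((connEvent ends o s)ᶜ ∩ connEvent ends o y) * (prob (Function.update p f 0) ((connEvent ends o s)ᶜ ∩ connEvent ends s u) + prob (Function.update p f 0) (connEvent ends o s ∩ connEvent ends s u)))) ((prob (Function.update p f 0) ((connEvent ends o s)ᶜ ∩ ((connEvent ends s y)ᶜ ∩ (connEvent ends o y)ᶜ) ∩ connEvent ends s u) + prob (Function.update p f 0) ((connEvent ends o s)ᶜ ∩ ((connEvent ends s y)ᶜ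 ∩ (connEvent ends o y)ᶜ) ∩ connEvent ends o u) + prob (Function.update p f 0) (connEvent ends o s ∩ (connEvent ends s y)ᶜ ∩ connEvent ends s u)) + 0 + (prob (Function.update p f 0) ((connEvent ends o s)ᶜ ∩ ((connEvent ends s y)ᶜ ∩ (connEvent ends o y)ᶜ)) + prob (Function.update p f 0) (connEvent ends o s ∩ (connEvent ends s y)ᶜ)) * (prob (Function.update p f 0) ((connEvent ends o s)ᶜ ∩ connEvent ends s u) + prob (Function.update p f 0) ((connEvent ends o s)ᶜ ∩ connEvent ends o u) + prob (Function.update p f 0) (connEvent ends o s ∩ connEvent ends s u)) - ((prob (Function.update p f 0) ((connEvent ends o s)ᶜ ∩ ((connEvent ends s y)ᶜ ∩ (connEvent ends o y)ᶜ) ∩ connEvent ends s u) + prob (Function.update p f 0) ((connEvent ends o s)ᶜ ∩ ((connEvent ends s y)ᶜ ∩ (connEvent ends o y)ᶜ) ∩ connEvent ends o u) + prob (Function.update p f 0) (connEvent ends o s ∩ (connEvent ends s y)ᶜ ∩ connEvent ends s u)) * 1 + (prob (Function.update p f 0) ((connEvent ends o s)ᶜ ∩ ((connEvent ends s y)ᶜ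 ∩ (connEvent ends o y)ᶜ)) + prob (Function.update p f 0) (connEvent ends o s ∩ (connEvent ends s y)ᶜ)) * (prob (Function.update p f 0) ((connEvent ends o s)ᶜ ∩ connEvent ends s u) + prob (Function.update p f 0) ((connEvent ends o s)ᶜ ∩ connEvent ends o u) + prob (Function.update p f 0) (connEvent ends o s ∩ connEvent ends s u)) + 0 * (prob (Function.update p f 0) ((connEvent ends o s)ᶜ ∩ connEvent ends s u) + prob (Function.update p f 0) ((connEvent ends o s)ᶜ ∩ connEvent ends o u) + prob (Function.update p f 0) (connEvent ends o s ∩ connEvent ends s u))))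
  nlinarith [hbhk, mul_nonneg hn hm1, mul_nonneg hm2 hm3, hmin1, hmin2]

end OEdgeProb

end Summit.Ventures.PercRepro2
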